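import Literature.IUT.HodgeArakelov.GaussianSplittingMonoids

/-!
# [IUTchII] Cor 3.5 (iii) / [IUTchIII] Prop 3.5 (ii)(c): pushing the tuple-level splitting monoid into
# label-dependent carriers (values)

Owner companion (abc-iut cell, layer L6; abc-iut-L6-t2; no re-typing), sequel to
`GaussianSplittingMonoids.lean`. The Gaussian / LGP splitting monoid `μ_{2l}^{diag} · ξ^ℕ ⊆ ∏_{j ∈ F_l^⋇} K`
([IUTchII] Cor 3.5 (iii) p. 95; the values `ξ_j = ζ_j · q_v^{j²}`) is, downstream, read inside carriers that
DEPEND ON THE LABEL `j` — in [IUTchIII] Prop 3.4 (ii) / 3.5 (ii)(c) p. 105 the component labelled `j` acts on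
`𝓘^ℚ(^{S^±_{j+1},j};D^⊢_v)`, the `j`-th factor of a `(j+1)`-fold tensor packet. This file records the image of
the splitting monoid under a LABEL-DEPENDENT family of monoid homomorphisms `f_j : K → R_j`:

* `piMap f : (∏_j K) →* ∏_j R_j`, `x ↦ (f_j (x_j))_j`;
* `gaussianSplittingMonoidIn f 2l ξ := (μ_{2l}^{diag} · ξ^ℕ).map (piMap f) ⊆ ∏_j R_j` with membership
  (`y = (f_j(ω · ξ_j^n))_j`, one `ω ∈ μ_{2l}(K)`, one `n`), componentwise reading in `O^⊥`-form
  (`y_j ∈ μ_{2l}(R_j) · f_j(ξ_j)^ℕ`), and the "acts multiplicatively" closure fact for subsets of `∏_j R_j`.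

Elementary monoid algebra; claim key `Mochizuki2012` DISPUTED (D-0012): nothing here asserts a disputed claim
or takes a side on [IUTchIII] Cor 3.12.
-/

namespace Literature.IUT.HodgeArakelov

universe u v w

section Push

variable {K : Type u} [CommMonoid K] {ι : Type v} {R : ι → Type w} [∀ j, CommMonoid (R j)]

/-- The label-dependent componentwise map `x ↦ (f_j (x_j))_j : ∏_j K → ∏_j R_j` (each `f_j` a monoid hom,
e.g. the structure map of `K_v` into the `j`-th log-shell / tensor-packet carrier).
[cite: Mochizuki2012, Cor 3.5 (iii) p.95] -/
def piMap (f : ∀ j : ι, K →* R j) : (ι → K) →* (∀ j, R j) :=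
  MonoidHom.pi fun j => (f j).comp (Pi.evalMonoidHom (fun _ : ι => K) j)

/-- Components of `piMap`. [cite: Mochizuki2012, Cor 3.5 (iii) p.95] -/
@[simp] theorem piMap_apply (f : ∀ j : ι, K →* R j) (x : ι → K) (j : ι) : piMap f x j = f j (x j) := rfl

/-- **The splitting monoid read in label-dependent carriers**: the image of `μ_{2l}^{diag} · ξ^ℕ` under
`(f_j)_j` ([IUTchII] Cor 3.5 (iii) p. 95 splitting of `Ψ_ξ`; [IUTchIII] Prop 3.5 (ii)(c) p. 105 `Ψ^⊥_{F_LGP}`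
componentwise in `𝓘^ℚ(^{S^±_{j+1},j};−)`). [cite: Mochizuki2012, Cor 3.5 (iii) p.95] -/
def gaussianSplittingMonoidIn (f : ∀ j : ι, K →* R j) (twoL : ℕ) (ξ : ι → K) : Submonoid (∀ j, R j) :=
  (gaussianSplittingMonoid K twoL ξ).map (piMap f)

/-- **Membership**: `y ∈ (f_j)_*(μ_{2l}^{diag} · ξ^ℕ)` iff `y = (f_j (ω · ξ_j^n))_j` for ONE `ω ∈ μ_{2l}(K)` and ONE
`n ∈ ℕ`. [cite: Mochizuki2012, Cor 3.5 (iii) p.95] -/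
theorem mem_gaussianSplittingMonoidIn_iff (f : ∀ j : ι, K →* R j) (twoL : ℕ) (ξ : ι → K) (y : ∀ j, R j) :
    y ∈ gaussianSplittingMonoidIn f twoL ξ ↔
      ∃ ω : Kˣ, ω ∈ rootsOfUnity twoL K ∧ ∃ n : ℕ, y = fun j => f j ((ω : K) * ξ j ^ n) := by
  unfold gaussianSplittingMonoidIn
  rw [Submonoid.mem_map]
  constructor
  · rintro ⟨x, hx, rfl⟩
    obtain ⟨ω, hω, n, rfl⟩ := (mem_gaussianSplittingMonoid_iff twoL ξ x).mp hx
    exact ⟨ω, hω, n, funext fun j => rfl⟩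
  · rintro ⟨ω, hω, n, rfl⟩
    exact ⟨fun i => (ω : K) * ξ i ^ n, (mem_gaussianSplittingMonoid_iff twoL ξ _).mpr ⟨ω, hω, n, rfl⟩,
      funext fun j => rfl⟩

/-- The image of `ξ^n` is `(f_j(ξ_j)^n)_j`, a member. [cite: Mochizuki2012, Cor 3.5 (iii) p.95] -/
theorem piMap_pow_mem_gaussianSplittingMonoidIn (f : ∀ j : ι, K →* R j) (twoL : ℕ) (ξ : ι → K) (n : ℕ) :
    piMap f (ξ ^ n) ∈ gaussianSplittingMonoidIn f twoL ξ :=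
  Submonoid.mem_map_of_mem _ (pow_mem_gaussianSplittingMonoid twoL ξ n)

/-- **Componentwise reading**: the `j`-th component of a member lies in `μ_{2l}(R_j) · f_j(ξ_j)^ℕ`
(`OPerp (R j) 2l (powers (f_j ξ_j))`, the `O^⊥`-shape of [IUTchII] Def 4.9 (ii) in the carrier `R_j`).
[cite: Mochizuki2012, Def 4.9 (ii) p.155] -/
theorem apply_mem_OPerp_of_mem_gaussianSplittingMonoidIn {f : ∀ j : ι, K →* R j} {twoL : ℕ} {ξ : ι → K}
    {y : ∀ j, R j} (hy : y ∈ gaussianSplittingMonoidIn f twoL ξ) (j : ι) :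
    y j ∈ OPerp (R j) twoL (Submonoid.powers (f j (ξ j))) := by
  obtain ⟨ω, hω, n, rfl⟩ := (mem_gaussianSplittingMonoidIn_iff f twoL ξ y).mp hy
  change f j ((ω : K) * ξ j ^ n) ∈ _
  rw [map_mul, map_pow]
  refine Submonoid.mul_mem _ (rootsOfUnity_mem_OPerp (R j) twoL _ (Units.map (f j) ω) ?_)
    (splitting_le_OPerp (R j) twoL _ ⟨n, rfl⟩)
  rw [mem_rootsOfUnity] at hω ⊢
  rw [← map_pow, hω, map_one]

/-- With a value-profile `ξ = (ζ_j · q^{e j})_j` (`ζ_j ∈ μ_{2l}` componentwise): the `j`-th component of a member lies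
in `μ_{2l}(R_j) · f_j(q)^{e j · ℕ}`. [cite: Mochizuki2012, Cor 3.5 (ii) p.94] -/
theorem apply_mem_OPerp_pow_of_mem_gaussianSplittingMonoidIn {f : ∀ j : ι, K →* R j} {twoL : ℕ} {q : K}
    {e : ι → ℕ} {ζ : ι → Kˣ} (hζ : ∀ j, ζ j ∈ rootsOfUnity twoL K) {y : ∀ j, R j}
    (hy : y ∈ gaussianSplittingMonoidIn f twoL (valueProfileOf q e ζ)) (j : ι) :
    y j ∈ OPerp (R j) twoL (Submonoid.powers (f j q ^ e j)) := by
  obtain ⟨ω, hω, n, rfl⟩ := (mem_gaussianSplittingMonoidIn_iff f twoL _ y).mp hy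
  change f j ((ω : K) * valueProfileOf q e ζ j ^ n) ∈ _
  rw [valueProfileOf_apply, mul_pow, ← mul_assoc, ← Units.val_pow_eq_pow_val, ← Units.val_mul, map_mul,
    map_pow, map_pow]
  refine Submonoid.mul_mem _ (rootsOfUnity_mem_OPerp (R j) twoL _ (Units.map (f j) (ω * ζ j ^ n)) ?_)
    (splitting_le_OPerp (R j) twoL _ ⟨n, rfl⟩)
  have hmem : ω * ζ j ^ n ∈ rootsOfUnity twoL K := Subgroup.mul_mem _ hω (Subgroup.pow_mem _ (hζ j) n)
  rw [mem_rootsOfUnity] at hmem ⊢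
  rw [← map_pow, hmem, map_one]

/-- **"Acts multiplicatively"** in the label-dependent carriers: a subset `M ⊆ ∏_j R_j` stable under
multiplication by `(f_j ξ_j)_j` and by `(f_j ω)_j` for `ω ∈ μ_{2l}(K)` is stable under every member.
[cite: Mochizuki2012, Cor 3.5 (iii) p.95] -/
theorem gaussianSplittingMonoidIn_mul_mem {f : ∀ j : ι, K →* R j} {twoL : ℕ} {ξ : ι → K}
    {M : Set (∀ j, R j)} (hξ : ∀ m ∈ M, piMap f ξ * m ∈ M)
    (hμ : ∀ ω : Kˣ, ω ∈ rootsOfUnity twoL K → ∀ m ∈ M, (piMap f fun _ => (ω : K)) * m ∈ M)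
    {y : ∀ j, R j} (hy : y ∈ gaussianSplittingMonoidIn f twoL ξ) {m : ∀ j, R j} (hm : m ∈ M) :
    y * m ∈ M := by
  obtain ⟨ω, hω, n, rfl⟩ := (mem_gaussianSplittingMonoidIn_iff f twoL ξ y).mp hy
  have hpow : ∀ k : ℕ, ∀ m ∈ M, piMap f ξ ^ k * m ∈ M := by
    intro k
    induction k with
    | zero => intro m hm; simpa using hm
    | succ k ih =>
      intro m hm
      rw [pow_succ, mul_assoc]
      exact ih _ (hξ m hm)
  have : (fun j => f j ((ω : K) * ξ j ^ n)) = (piMap f fun _ => (ω : K)) * piMap f ξ ^ n := by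
    funext j
    simp [piMap_apply, map_mul, map_pow, Pi.mul_apply, Pi.pow_apply]
  rw [this, mul_assoc]
  exact hμ ω hω _ (hpow n m hm)

end Push

end Literature.IUT.HodgeArakelov
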